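import Literature.NumberTheory.LFunctions.HalaszEulerProduct
import Literature.NumberTheory.LFunctions.MellinPlancherel
import Literature.NumberTheory.LFunctions.DirichletMVTSharp
import Literature.NumberTheory.LFunctions.PoissonSmoothing
import Mathlib.NumberTheory.Chebyshev
import HarnessLib

/-!
# Halász's theorem, III: the mean square of the logarithmically weighted partial sums

Third file of the proof of Halász's theorem in the Halász–Montgomery–Tenenbaum form
(`Literature.NumberTheory.Sieve.halaszMontgomeryTenenbaum`), following Granville–Soundararajan,
*Decay of mean values of multiplicative functions* (2003), §3b.  For a completely multiplicative
`g : ℕ → ℂ` with `|g| ≤ 1`, its `(N+1)`-smooth truncation `g̃ = smoothCut g N`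
(`HalaszEulerProduct.lean`), `G(s) = ∑ g̃(n) n^{-s}`, `D(s) = ∑ g̃(n) log n · n^{-s} = P(s) G(s)` with
`P(s) = ∑ g̃(n)Λ(n) n^{-s}`, and `A(y) = ∑_{n ≤ y} g̃(n) log n`, we bound the weighted mean square
`J(α) = ∫_ℝ |A(e^u)|² e^{-2(1+α)u} du` (`0 < α ≤ 1`), which by the Mellin–Plancherel identity
(`MellinPlancherel.lean`, GS03 (3.10)) equals `(1/2π) ∫_ℝ |D(1+α+iy)|²/|1+α+iy|² dy`, in terms of a
bound `B` for `|G(1+α+iy)|` on a window `|y| ≤ T₀` (GS03 Lemma 3.2, completely multiplicative case,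
with cruder but explicit constants):

`J(α) ≤ 18 B²/α + 223 e^{10} / (T₀ α³)`      (`T₀ ≥ 2`).

The window `|y| ≤ T₀` is treated by `|D|² = |P|²|G|² ≤ B²|P|²` and a second application of
Mellin–Plancherel to `P`, whose partial sums are `≤ ψ(y) ≤ (log 4 + 4) y` (Chebyshev, Mathlib); the
tails `|y| > T₀` are cut into unit blocks on which the mean value theorem sharp in the length
(`DirichletMVTSharp.lean`, Montgomery–Vaughan 1974 Cor. 3 in weak explicit form) and the Rankin bound
`∑ n |g̃(n) log n / n^{1+α}|² ≤ 4e^{10}/α³` (`HalaszEulerProduct.lean`) give `≤ 350 e^{10}/α³` per block,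
with block weights `1/(1 + (T₀+k)²)` summing to `≤ 2/T₀`.

## Main results
- `Literature.NumberTheory.LFunctions.Halasz.meanSquare_mulVM_le` : `∫ |∑_{n ≤ e^u} g̃Λ|² e^{-2(1+α)u} du ≤ 18/α`.
- `Literature.NumberTheory.LFunctions.Halasz.meanSquare_mulLog_le` : the displayed bound for `J(α)`.

## References
- [GranvilleSoundararajan2003] A. Granville, K. Soundararajan, *Decay of mean values of
  multiplicative functions*, Canad. J. Math. 55 (2003), §3b, (3.9)–(3.14) and Lemma 3.2.
- [MontgomeryVaughan1974] H. L. Montgomery, R. C. Vaughan, *Hilbert's inequality*, Cor. 3.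

## Design choices
* Everything is on the line `Re s = 1 + α` with `0 < α ≤ 1`; `T₀ ≥ 2` (in Halász's theorem `T₀ = T/2`,
  the range `T < 4` being trivial); constants are explicit but not optimised (HMT only needs `1/√T`).
* `N` is arbitrary here (`N = ⌊x⌋` downstream); only `D = P · G` uses complete multiplicativity.
-/

noncomputable section

open Finset Real Complex MeasureTheory Set Filter

namespace Literature.NumberTheory.LFunctions

namespace Halasz

open MellinPlancherel (psum)

variable {g : ℕ → ℂ} {N : ℕ}

/-! ### Growth of the partial sums of `g̃ Λ` and `g̃ log` -/

/-- `|∑_{n ≤ y} g̃(n)Λ(n)| ≤ ψ(y)`. [folklore] -/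
theorem norm_psum_mulVM_le_psi (hgb : ∀ n, ‖g n‖ ≤ 1) (y : ℝ) :
    ‖psum (mulVM g N) y‖ ≤ Chebyshev.psi y := by
  unfold psum
  rw [Chebyshev.psi_eq_sum_Icc]
  calc ‖∑ n ∈ Icc 1 ⌊y⌋₊, mulVM g N n‖ ≤ ∑ n ∈ Icc 1 ⌊y⌋₊, ‖mulVM g N n‖ := norm_sum_le _ _
    _ ≤ ∑ n ∈ Icc 1 ⌊y⌋₊, ArithmeticFunction.vonMangoldt n :=
        Finset.sum_le_sum fun n _ => norm_mulVM_le hgb n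
    _ ≤ ∑ n ∈ Icc 0 ⌊y⌋₊, ArithmeticFunction.vonMangoldt n := by
        refine Finset.sum_le_sum_of_subset_of_nonneg (fun n hn => ?_)
          (fun _ _ _ => ArithmeticFunction.vonMangoldt_nonneg)
        simp only [Finset.mem_Icc] at hn ⊢
        exact ⟨by omega, hn.2⟩

/-- `|∑_{n ≤ y} g̃(n)Λ(n)| ≤ 6 y` for `y ≥ 1` (Chebyshev: `ψ(y) ≤ (log 4 + 4) y`). [folklore] -/
theorem norm_psum_mulVM_le (hgb : ∀ n, ‖g n‖ ≤ 1) (y : ℝ) (hy : 1 ≤ y) :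
    ‖psum (mulVM g N) y‖ ≤ 6 * y ^ (1 : ℝ) := by
  rw [Real.rpow_one]
  refine (norm_psum_mulVM_le_psi hgb y).trans ((Chebyshev.psi_le_const_mul_self (by linarith)).trans ?_)
  have h4 : Real.log 4 ≤ 2 := by
    have := Real.log_le_sub_one_of_pos (show (0:ℝ) < 4 by norm_num)
    have h2 : Real.log 4 = 2 * Real.log 2 := by
      rw [show (4:ℝ) = 2 ^ 2 by norm_num, Real.log_pow]; ring
    rw [h2]; linarith [Real.log_two_lt_d9]
  nlinarith

/-- `|∑_{n ≤ y} g̃(n) log n| ≤ (2/α) y^{1 + α/2}` for `y ≥ 1`, `α > 0`. [folklore] -/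
theorem norm_psum_mulLog_le (hgb : ∀ n, ‖g n‖ ≤ 1) {α : ℝ} (hα : 0 < α) (y : ℝ) (hy : 1 ≤ y) :
    ‖psum (mulLog g N) y‖ ≤ 2 / α * y ^ (1 + α / 2) := by
  unfold psum
  have hy0 : 0 ≤ y := by linarith
  calc ‖∑ n ∈ Icc 1 ⌊y⌋₊, mulLog g N n‖ ≤ ∑ n ∈ Icc 1 ⌊y⌋₊, ‖mulLog g N n‖ := norm_sum_le _ _
    _ ≤ ∑ n ∈ Icc 1 ⌊y⌋₊, 2 / α * y ^ (α / 2) := by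
        refine Finset.sum_le_sum fun n hn => (norm_mulLog_le hgb n).trans ?_
        refine (log_le_rpow_half hα n).trans ?_
        have hn' : (n : ℝ) ≤ y := by
          simp only [Finset.mem_Icc] at hn
          exact (Nat.cast_le.2 hn.2).trans (Nat.floor_le hy0)
        gcongr
    _ = ⌊y⌋₊ * (2 / α * y ^ (α / 2)) := by rw [Finset.sum_const, Nat.card_Icc, nsmul_eq_mul]; simp
    _ ≤ y * (2 / α * y ^ (α / 2)) := by gcongr; exact Nat.floor_le hy0
    _ = 2 / α * y ^ (1 + α / 2) := by
        rw [Real.rpow_add (by linarith), Real.rpow_one]; ring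

/-- `∑ |g̃(n) log n| n^{-σ} < ∞` for `σ > 1`. [folklore] -/
theorem summable_norm_mulLog_div_rpow (hgb : ∀ n, ‖g n‖ ≤ 1) {σ : ℝ} (hσ : 1 < σ) :
    Summable fun n : ℕ => ‖mulLog g N n‖ / (n : ℝ) ^ σ := by
  have h := (LSeriesSummable_mulLog (g := g) (N := N) hgb (s := (σ : ℂ)) (by simpa using hσ)).norm
  refine h.congr fun n => ?_
  rcases Nat.eq_zero_or_pos n with rfl | hn
  · simp [mulLog_zero]
  · rw [LSeries.norm_term_eq, if_neg hn.ne', Complex.ofReal_re]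

/-- `∑ |g̃(n) Λ(n)| n^{-σ} < ∞` for `σ > 1`. [folklore] -/
theorem summable_norm_mulVM_div_rpow (hgb : ∀ n, ‖g n‖ ≤ 1) {σ : ℝ} (hσ : 1 < σ) :
    Summable fun n : ℕ => ‖mulVM g N n‖ / (n : ℝ) ^ σ := by
  have h := (LSeriesSummable_mulVM (g := g) (N := N) hgb (s := (σ : ℂ)) (by simpa using hσ)).norm
  refine h.congr fun n => ?_
  rcases Nat.eq_zero_or_pos n with rfl | hn
  · simp [mulVM_zero]
  · rw [LSeries.norm_term_eq, if_neg hn.ne', Complex.ofReal_re]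

/-- `∑ |g̃(n)| n^{-σ} < ∞` for `σ > 0` (finite Euler product). [folklore] -/
theorem summable_norm_smoothCut_div_rpow (hg : ∀ m n, g (m * n) = g m * g n) (hg1 : g 1 = 1)
    (hgb : ∀ n, ‖g n‖ ≤ 1) {σ : ℝ} (hσ : 0 < σ) :
    Summable fun n : ℕ => ‖smoothCut g N n‖ / (n : ℝ) ^ σ := by
  have h := (LSeriesSummable_smoothCut (N := N) hg hg1 hgb (s := (σ : ℂ)) (by simpa using hσ)).norm
  refine h.congr fun n => ?_
  rcases Nat.eq_zero_or_pos n with rfl | hn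
  · simp [smoothCut_zero]
  · rw [LSeries.norm_term_eq, if_neg hn.ne', Complex.ofReal_re]

/-! ### Dirichlet series on vertical lines: continuity and an integrable majorant -/

/-- On a line of absolute convergence `Re s = σ`, `y ↦ L(σ + iy)` is continuous. [folklore] -/
theorem continuous_LSeries_line {a : ℕ → ℂ} {σ : ℝ}
    (hsum : Summable fun n : ℕ => ‖a n‖ / (n : ℝ) ^ σ) :
    Continuous fun y : ℝ => LSeries a (σ + y * I) := by
  have hcont : ∀ n, Continuous fun y : ℝ => LSeries.term a (σ + y * I) n := fun n => by
    simpa using PoissonSmoothing.continuous_term (a := a) (σ₀ := σ) 0 n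
  refine continuous_tsum hcont hsum fun n y => ?_
  rcases Nat.eq_zero_or_pos n with rfl | hn
  · simp only [LSeries.term_zero, norm_zero]; positivity
  · rw [PoissonSmoothing.norm_term_line_eq y hn]

/-- `|L(σ+iy)|²/|σ+iy|² ≤ S²/(1+y²)` for `σ ≥ 1`, where `S = ∑ |a_n| n^{-σ}`; hence the left side is
integrable over `ℝ`. [folklore] -/
theorem integrable_norm_LSeries_sq_div {a : ℕ → ℂ} {σ : ℝ} (hσ : 1 ≤ σ)
    (hsum : Summable fun n : ℕ => ‖a n‖ / (n : ℝ) ^ σ) :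
    Integrable fun y : ℝ => ‖LSeries a (σ + y * I)‖ ^ 2 / ‖(σ : ℂ) + y * I‖ ^ 2 := by
  set S : ℝ := ∑' n : ℕ, ‖a n‖ / (n : ℝ) ^ σ with hS
  have hS0 : 0 ≤ S := tsum_nonneg fun n => by positivity
  have hmeas : AEStronglyMeasurable
      (fun y : ℝ => ‖LSeries a (σ + y * I)‖ ^ 2 / ‖(σ : ℂ) + y * I‖ ^ 2) volume := by
    refine (Continuous.aestronglyMeasurable ?_)
    refine ((continuous_LSeries_line hsum).norm.pow 2).div ((Continuous.norm ?_).pow 2) fun y => ?_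
    · fun_prop
    · have : ((σ : ℂ) + y * I) ≠ 0 := by
        intro h
        have := congrArg Complex.re h
        simp at this
        linarith
      positivity
  refine Integrable.mono' ((integrable_inv_one_add_sq).const_mul (S ^ 2)) hmeas
    (Filter.Eventually.of_forall fun y => ?_)
  rw [Real.norm_of_nonneg (by positivity)]
  have hnum : ‖LSeries a (σ + y * I)‖ ^ 2 ≤ S ^ 2 := by
    have := PoissonSmoothing.norm_LSeries_le_tsum hsum y
    exact pow_le_pow_left₀ (norm_nonneg _) this 2
  have hden : 1 + y ^ 2 ≤ ‖(σ : ℂ) + y * I‖ ^ 2 := by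
    rw [Complex.sq_norm, Complex.normSq_apply]
    simp
    nlinarith
  have hpos : 0 < 1 + y ^ 2 := by positivity
  calc ‖LSeries a (σ + y * I)‖ ^ 2 / ‖(σ : ℂ) + y * I‖ ^ 2
      ≤ S ^ 2 / (1 + y ^ 2) := by gcongr
    _ = S ^ 2 * (1 + y ^ 2)⁻¹ := by rw [div_eq_mul_inv]


/-! ### Mellin–Plancherel for `g̃ log` and `g̃ Λ` -/

/-- The line `Re s = 1 + α`: real part. [folklore] -/
theorem one_add_re (α y : ℝ) : ((1 : ℂ) + α + y * I).re = 1 + α := by simp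

/-- The point `1 + α + iy` is `(1+α : ℝ) + iy`. [folklore] -/
theorem ofReal_one_add (α : ℝ) : (((1 + α : ℝ)) : ℂ) = 1 + (α : ℂ) := by push_cast; ring

/-- **GS03 (3.10)** for `g̃ log`: `J(α) = ∫ |A(e^u)|² e^{-2(1+α)u} du = (1/2π) ∫ |D(1+α+iy)|²/|1+α+iy|² dy`.
[cite: GranvilleSoundararajan2003, (3.10)] -/
theorem meanSquare_mulLog_eq (hgb : ∀ n, ‖g n‖ ≤ 1) {α : ℝ} (hα : 0 < α) :
    ∫ u : ℝ, ‖psum (mulLog g N) (Real.exp u)‖ ^ 2 * Real.exp (-(2 * (1 + α) * u)) =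
      (1 / (2 * π)) * ∫ y : ℝ, ‖LSeries (mulLog g N) (1 + α + y * I)‖ ^ 2 /
        ‖(1 : ℂ) + α + y * I‖ ^ 2 := by
  have h := MellinPlancherel.integral_norm_sq_psum_exp (a := mulLog g N) (σ := 1 + α)
    (θ := 1 + α / 2) (C := 2 / α) (by linarith) (summable_norm_mulLog_div_rpow hgb (by linarith))
    (by linarith) (fun y hy => norm_psum_mulLog_le hgb hα y hy)
  simpa only [ofReal_one_add] using h

/-- Mellin–Plancherel for `g̃ Λ`: `∫ |∑_{n ≤ e^u} g̃Λ|² e^{-2(1+α)u} du = (1/2π) ∫ |P(1+α+iy)|²/|1+α+iy|² dy`.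
[cite: GranvilleSoundararajan2003, §3b (display before (3.14))] -/
theorem meanSquare_mulVM_eq (hgb : ∀ n, ‖g n‖ ≤ 1) {α : ℝ} (hα : 0 < α) :
    ∫ u : ℝ, ‖psum (mulVM g N) (Real.exp u)‖ ^ 2 * Real.exp (-(2 * (1 + α) * u)) =
      (1 / (2 * π)) * ∫ y : ℝ, ‖LSeries (mulVM g N) (1 + α + y * I)‖ ^ 2 /
        ‖(1 : ℂ) + α + y * I‖ ^ 2 := by
  have h := MellinPlancherel.integral_norm_sq_psum_exp (a := mulVM g N) (σ := 1 + α)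
    (θ := 1) (C := 6) (by linarith) (summable_norm_mulVM_div_rpow hgb (by linarith))
    (by linarith) (fun y hy => norm_psum_mulVM_le hgb y hy)
  simpa only [ofReal_one_add] using h

/-- **The `Λ`-weighted mean square** (GS03, display before (3.14), crude form):
`∫ |∑_{n ≤ e^u} g̃(n)Λ(n)|² e^{-2(1+α)u} du ≤ 18/α`, from `ψ(y) ≤ 6y`.
[cite: GranvilleSoundararajan2003, §3b] -/
theorem meanSquare_mulVM_le (hgb : ∀ n, ‖g n‖ ≤ 1) {α : ℝ} (hα : 0 < α) :
    ∫ u : ℝ, ‖psum (mulVM g N) (Real.exp u)‖ ^ 2 * Real.exp (-(2 * (1 + α) * u)) ≤ 18 / α := by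
  set F : ℝ → ℝ := (Set.Ici (0 : ℝ)).indicator (fun u => 36 * Real.exp (-(2 * α) * u)) with hF
  have hIoi : IntegrableOn (fun u => 36 * Real.exp (-(2 * α) * u)) (Set.Ioi (0 : ℝ)) :=
    (integrableOn_exp_mul_Ioi (by linarith : -(2 * α) < 0) 0).const_mul 36
  have hIci : IntegrableOn (fun u => 36 * Real.exp (-(2 * α) * u)) (Set.Ici (0 : ℝ)) :=
    (integrableOn_Ici_iff_integrableOn_Ioi).2 hIoi
  have hFint : Integrable F := by
    rw [hF, integrable_indicator_iff measurableSet_Ici]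
    exact hIci
  have hle : ∀ u : ℝ,
      ‖psum (mulVM g N) (Real.exp u)‖ ^ 2 * Real.exp (-(2 * (1 + α) * u)) ≤ F u := by
    intro u
    by_cases hu : 0 ≤ u
    · rw [hF, Set.indicator_of_mem (Set.mem_Ici.2 hu)]
      have h1 : (1 : ℝ) ≤ Real.exp u := by simpa using Real.one_le_exp hu
      have hb := norm_psum_mulVM_le (N := N) hgb (Real.exp u) h1
      rw [Real.rpow_one] at hb
      have hexp : (6 * Real.exp u) ^ 2 * Real.exp (-(2 * (1 + α) * u)) =
          36 * Real.exp (-(2 * α) * u) := by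
        rw [mul_pow, sq (Real.exp u), ← Real.exp_add, mul_assoc, ← Real.exp_add]
        congr 1
        · norm_num
        · congr 1; ring
      calc ‖psum (mulVM g N) (Real.exp u)‖ ^ 2 * Real.exp (-(2 * (1 + α) * u))
          ≤ (6 * Real.exp u) ^ 2 * Real.exp (-(2 * (1 + α) * u)) := by
            gcongr
        _ = 36 * Real.exp (-(2 * α) * u) := hexp
    · push Not at hu
      rw [hF, Set.indicator_of_notMem (by simpa using hu),
        MellinPlancherel.psum_of_lt_one _ (by simpa using Real.exp_lt_one_iff.mpr hu)]
      simp
  have hnonneg : 0 ≤ᵐ[volume] fun u : ℝ =>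
      ‖psum (mulVM g N) (Real.exp u)‖ ^ 2 * Real.exp (-(2 * (1 + α) * u)) :=
    Filter.Eventually.of_forall fun u => by positivity
  calc ∫ u : ℝ, ‖psum (mulVM g N) (Real.exp u)‖ ^ 2 * Real.exp (-(2 * (1 + α) * u))
      ≤ ∫ u, F u := integral_mono_of_nonneg hnonneg hFint (Filter.Eventually.of_forall hle)
    _ = 36 * (1 / (2 * α)) := by
        rw [hF, integral_indicator measurableSet_Ici, integral_Ici_eq_integral_Ioi,
          integral_const_mul, integral_exp_mul_Ioi (by linarith : -(2 * α) < 0) 0]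
        congr 1
        simp only [mul_zero, Real.exp_zero]
        field_simp
    _ = 18 / α := by field_simp; ring

/-! ### The factorisation `D = P · G` on the line `Re s = 1 + α` and the window `|y| ≤ T₀` -/

/-- `D(1+α+iy) = P(1+α+iy) G(1+α+iy)` (complete multiplicativity). [cite: GranvilleSoundararajan2003, §3b] -/
theorem LSeries_mulLog_line (hg : ∀ m n, g (m * n) = g m * g n) (hg1 : g 1 = 1)
    (hgb : ∀ n, ‖g n‖ ≤ 1) {α : ℝ} (hα : 0 < α) (y : ℝ) :
    LSeries (mulLog g N) (1 + α + y * I) =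
      LSeries (mulVM g N) (1 + α + y * I) * LSeries (smoothCut g N) (1 + α + y * I) :=
  LSeries_mulLog_eq hg hg1 hgb (by rw [one_add_re]; linarith)

/-- **The window** (GS03 (3.12), completely multiplicative case): if `|G(1+α+iy)| ≤ B` for
`|y| ≤ T₀`, then `∫_{|y| ≤ T₀} |D|²/|s|² ≤ B² ∫_ℝ |P|²/|s|²`. [cite: GranvilleSoundararajan2003, (3.12)] -/
theorem setIntegral_window_le (hg : ∀ m n, g (m * n) = g m * g n) (hg1 : g 1 = 1)
    (hgb : ∀ n, ‖g n‖ ≤ 1) {α : ℝ} (hα : 0 < α) {T₀ B : ℝ}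
    (hB : ∀ y : ℝ, |y| ≤ T₀ → ‖LSeries (smoothCut g N) (1 + α + y * I)‖ ≤ B) :
    ∫ y in Set.Icc (-T₀) T₀, ‖LSeries (mulLog g N) (1 + α + y * I)‖ ^ 2 /
        ‖(1 : ℂ) + α + y * I‖ ^ 2 ≤
      B ^ 2 * ∫ y : ℝ, ‖LSeries (mulVM g N) (1 + α + y * I)‖ ^ 2 / ‖(1 : ℂ) + α + y * I‖ ^ 2 := by
  have hsumD := summable_norm_mulLog_div_rpow (N := N) hgb (σ := 1 + α) (by linarith)
  have hsumP := summable_norm_mulVM_div_rpow (N := N) hgb (σ := 1 + α) (by linarith)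
  have hintD := integrable_norm_LSeries_sq_div (a := mulLog g N) (σ := 1 + α) (by linarith) hsumD
  have hintP := integrable_norm_LSeries_sq_div (a := mulVM g N) (σ := 1 + α) (by linarith) hsumP
  simp only [ofReal_one_add] at hintD hintP
  have hP0 : 0 ≤ᵐ[volume] fun y : ℝ =>
      ‖LSeries (mulVM g N) (1 + α + y * I)‖ ^ 2 / ‖(1 : ℂ) + α + y * I‖ ^ 2 :=
    Filter.Eventually.of_forall fun y => by positivity
  calc ∫ y in Set.Icc (-T₀) T₀, ‖LSeries (mulLog g N) (1 + α + y * I)‖ ^ 2 /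
          ‖(1 : ℂ) + α + y * I‖ ^ 2
      ≤ ∫ y in Set.Icc (-T₀) T₀, B ^ 2 * (‖LSeries (mulVM g N) (1 + α + y * I)‖ ^ 2 /
          ‖(1 : ℂ) + α + y * I‖ ^ 2) := by
        refine setIntegral_mono_on hintD.integrableOn (hintP.const_mul _).integrableOn
          measurableSet_Icc fun y hy => ?_
        have hyT : |y| ≤ T₀ := abs_le.2 ⟨by linarith [hy.1], hy.2⟩
        rw [LSeries_mulLog_line hg hg1 hgb hα y, norm_mul, mul_pow]
        have hG2 : ‖LSeries (smoothCut g N) (1 + α + y * I)‖ ^ 2 ≤ B ^ 2 :=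
          pow_le_pow_left₀ (norm_nonneg _) (hB y hyT) 2
        calc ‖LSeries (mulVM g N) (1 + α + y * I)‖ ^ 2 *
              ‖LSeries (smoothCut g N) (1 + α + y * I)‖ ^ 2 / ‖(1 : ℂ) + α + y * I‖ ^ 2
            ≤ ‖LSeries (mulVM g N) (1 + α + y * I)‖ ^ 2 * B ^ 2 / ‖(1 : ℂ) + α + y * I‖ ^ 2 := by
              gcongr
          _ = B ^ 2 * (‖LSeries (mulVM g N) (1 + α + y * I)‖ ^ 2 / ‖(1 : ℂ) + α + y * I‖ ^ 2) := by
              ring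
    _ = B ^ 2 * ∫ y in Set.Icc (-T₀) T₀, ‖LSeries (mulVM g N) (1 + α + y * I)‖ ^ 2 /
          ‖(1 : ℂ) + α + y * I‖ ^ 2 := integral_const_mul _ _
    _ ≤ B ^ 2 * ∫ y : ℝ, ‖LSeries (mulVM g N) (1 + α + y * I)‖ ^ 2 /
          ‖(1 : ℂ) + α + y * I‖ ^ 2 := by
        exact mul_le_mul_of_nonneg_left (setIntegral_le_integral hintP hP0) (sq_nonneg B)


/-! ### The tails `|y| > T₀`: unit blocks and the mean value theorem -/

/-- On the line `Re s = 1 + α`, `D(1+α+it) = ∑ c_n n^{-it}` with `c_n = g̃(n) log n / n^{1+α}`.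
[folklore] -/
theorem LSeries_mulLog_line_eq_tsum (α t : ℝ) :
    LSeries (mulLog g N) (1 + α + t * I) =
      ∑' n : ℕ, LSeries.term (mulLog g N) (1 + α) n * (n : ℂ) ^ (-((t : ℂ) * I)) := by
  unfold LSeries
  congr 1
  ext n
  rcases Nat.eq_zero_or_pos n with rfl | hn
  · simp
  · have hn0 : (n : ℂ) ≠ 0 := by exact_mod_cast hn.ne'
    rw [LSeries.term_of_ne_zero hn.ne', LSeries.term_of_ne_zero hn.ne',
      Complex.cpow_add _ _ hn0, Complex.cpow_neg, div_mul_eq_div_div, div_eq_mul_inv]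

/-- **One unit block** (Montgomery–Vaughan's mean value theorem, sharp in the length, and Rankin's
bound): `∫_a^{a+1} |D(1+α+it)|² dt ≤ 350 e^{10}/α³` for `0 < α ≤ 1`.
[cite: MontgomeryVaughan1974, Corollary 3] -/
theorem integral_unit_block_le (hgb : ∀ n, ‖g n‖ ≤ 1) {α : ℝ} (hα : 0 < α) (hα1 : α ≤ 1) (a : ℝ) :
    ∫ t in a..(a + 1), ‖LSeries (mulLog g N) (1 + α + t * I)‖ ^ 2 ≤ 350 * Real.exp 10 / α ^ 3 := by
  set c : ℕ → ℂ := fun n => LSeries.term (mulLog g N) (1 + α) n with hc_def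
  have hc : Summable fun n => ‖c n‖ :=
    (LSeriesSummable_mulLog (g := g) (N := N) hgb (s := 1 + α) (by simp; linarith)).norm
  obtain ⟨hc2, hR⟩ := tsum_mul_norm_term_mulLog_sq_le (g := g) (N := N) hgb hα hα1
  have h0 : c 0 = 0 := LSeries.term_zero _ _
  have hmvt := DirichletMVT.meanSquare_tsum_shift_le hc hc2 h0 (W := 1 / 2) (by norm_num) (a + 1 / 2)
  have hlo : a + 1 / 2 - 1 / 2 = a := by ring
  have hhi : a + 1 / 2 + 1 / 2 = a + 1 := by ring
  rw [hlo, hhi] at hmvt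
  have hint : ∫ t in a..(a + 1), ‖LSeries (mulLog g N) (1 + α + t * I)‖ ^ 2 =
      ∫ t in a..(a + 1), ‖∑' n : ℕ, c n * (n : ℂ) ^ (-((t : ℂ) * I))‖ ^ 2 := by
    refine intervalIntegral.integral_congr fun t _ => ?_
    simp only [hc_def, LSeries_mulLog_line_eq_tsum]
  rw [hint]
  refine hmvt.trans ?_
  have hterm : ∀ n : ℕ, (5 * (1 / 2 : ℝ) + 20 + 65 * n) * ‖c n‖ ^ 2 ≤ 175 / 2 * (n * ‖c n‖ ^ 2) := by
    intro n
    rcases Nat.eq_zero_or_pos n with rfl | hn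
    · simp [h0]
    · have hn1 : (1 : ℝ) ≤ n := by exact_mod_cast hn
      have hc0 : 0 ≤ ‖c n‖ ^ 2 := sq_nonneg _
      nlinarith
  have hsumL : Summable fun n : ℕ => (5 * (1 / 2 : ℝ) + 20 + 65 * n) * ‖c n‖ ^ 2 := by
    refine Summable.of_nonneg_of_le (fun n => by positivity) hterm (hc2.mul_left _)
  calc ∑' n : ℕ, (5 * (1 / 2 : ℝ) + 20 + 65 * n) * ‖c n‖ ^ 2
      ≤ ∑' n : ℕ, 175 / 2 * (n * ‖c n‖ ^ 2) := hsumL.tsum_le_tsum hterm (hc2.mul_left _)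
    _ = 175 / 2 * ∑' n : ℕ, (n * ‖c n‖ ^ 2) := tsum_mul_left
    _ ≤ 175 / 2 * (4 * Real.exp 10 / α ^ 3) := by gcongr
    _ = 350 * Real.exp 10 / α ^ 3 := by ring

/-- `y ↦ |D(1+α+iy)|²/|1+α+iy|²` is integrable over `ℝ` (`0 < α`). [folklore] -/
theorem integrable_normSq_mulLog_div (hgb : ∀ n, ‖g n‖ ≤ 1) {α : ℝ} (hα : 0 < α) :
    Integrable (fun y : ℝ => ‖LSeries (mulLog g N) (1 + α + y * I)‖ ^ 2 / ‖(1 : ℂ) + α + y * I‖ ^ 2) := by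
  have h := integrable_norm_LSeries_sq_div (a := mulLog g N) (σ := 1 + α) (by linarith)
    (summable_norm_mulLog_div_rpow hgb (by linarith))
  simp only [ofReal_one_add] at h
  exact h

/-- `y ↦ |D(1+α+iy)|²` is continuous. [folklore] -/
theorem continuous_norm_LSeries_mulLog_sq (hgb : ∀ n, ‖g n‖ ≤ 1) {α : ℝ} (hα : 0 < α) :
    Continuous fun y : ℝ => ‖LSeries (mulLog g N) (1 + α + y * I)‖ ^ 2 := by
  have h := continuous_LSeries_line (a := mulLog g N) (σ := 1 + α)
    (summable_norm_mulLog_div_rpow hgb (by linarith))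
  simp only [ofReal_one_add] at h
  exact (h.norm).pow 2

/-- Weight comparison on a block: if `a ≤ |y|` with `a ≥ 0` then
`|D|²/|1+α+iy|² ≤ |D|²/(1+a²)`. [folklore] -/
theorem normSq_div_le_of_le_abs {α a y : ℝ} (hα : 0 ≤ α) (ha : 0 ≤ a) (hy : a ≤ |y|) :
‖LSeries (mulLog g N) (1 + α + y * I)‖ ^ 2
        / ‖(1 : ℂ) + α + y * I‖ ^ 2 ≤ ‖LSeries (mulLog g N) (1 + α + y * I)‖ ^ 2 / (1 + a ^ 2) := by
  have hden : 1 + a ^ 2 ≤ ‖(1 : ℂ) + α + y * I‖ ^ 2 := by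
    rw [Complex.sq_norm, Complex.normSq_apply]
    simp only [add_re, one_re, ofReal_re, mul_re, I_re, mul_zero, ofReal_im, I_im, mul_one,
      sub_self, add_zero, add_im, one_im, zero_add, mul_im]
    have hy2 : a ^ 2 ≤ y ^ 2 := by
      calc a ^ 2 ≤ |y| ^ 2 := pow_le_pow_left₀ ha hy 2
        _ = y ^ 2 := sq_abs y
    nlinarith
  have hpos : 0 < 1 + a ^ 2 := by positivity
  gcongr

/-- A unit block `(a, a+1]` to the right of the window: `∫ ≤ (350 e^{10}/α³)/(1+a²)`. [folklore] -/
theorem setIntegral_Ioc_block_le (hgb : ∀ n, ‖g n‖ ≤ 1) {α : ℝ} (hα : 0 < α) (hα1 : α ≤ 1)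
    {a : ℝ} (ha : 0 ≤ a) :
    ∫ y in Set.Ioc a (a + 1), ‖LSeries (mulLog g N) (1 + α + y * I)‖ ^ 2
            / ‖(1 : ℂ) + α + y * I‖ ^ 2 ≤ 350 * Real.exp 10 / α ^ 3 / (1 + a ^ 2) := by
  have hint := integrable_normSq_mulLog_div (N := N) hgb hα
  have hcont := continuous_norm_LSeries_mulLog_sq (N := N) hgb hα
  have hpos : 0 < 1 + a ^ 2 := by positivity
  calc ∫ y in Set.Ioc a (a + 1), ‖LSeries (mulLog g N) (1 + α + y * I)‖ ^ 2 / ‖(1 : ℂ) + α + y * I‖ ^ 2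
      ≤ ∫ y in Set.Ioc a (a + 1), ‖LSeries (mulLog g N) (1 + α + y * I)‖ ^ 2 / (1 + a ^ 2) := by
        refine setIntegral_mono_on hint.integrableOn ?_ measurableSet_Ioc fun y hy => ?_
        · exact (hcont.div_const _).integrableOn_Icc.mono_set Set.Ioc_subset_Icc_self
        · exact normSq_div_le_of_le_abs hα.le ha
            (by rw [abs_of_nonneg (ha.trans hy.1.le)]; exact hy.1.le)
    _ = (∫ y in a..(a + 1), ‖LSeries (mulLog g N) (1 + α + y * I)‖ ^ 2) / (1 + a ^ 2) := by
        rw [intervalIntegral.integral_of_le (by linarith), integral_div]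
    _ ≤ 350 * Real.exp 10 / α ^ 3 / (1 + a ^ 2) := by
        gcongr
        exact integral_unit_block_le hgb hα hα1 a

/-- A unit block `[-(a+1), -a)` to the left of the window: `∫ ≤ (350 e^{10}/α³)/(1+a²)`. [folklore] -/
theorem setIntegral_Ico_block_le (hgb : ∀ n, ‖g n‖ ≤ 1) {α : ℝ} (hα : 0 < α) (hα1 : α ≤ 1)
    {a : ℝ} (ha : 0 ≤ a) :
    ∫ y in Set.Ico (-(a + 1)) (-a), ‖LSeries (mulLog g N) (1 + α + y * I)‖ ^ 2 / ‖(1 : ℂ) + α + y * I‖ ^ 2 ≤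
      350 * Real.exp 10 / α ^ 3 / (1 + a ^ 2) := by
  have hint := integrable_normSq_mulLog_div (N := N) hgb hα
  have hcont := continuous_norm_LSeries_mulLog_sq (N := N) hgb hα
  have hpos : 0 < 1 + a ^ 2 := by positivity
  calc ∫ y in Set.Ico (-(a + 1)) (-a), ‖LSeries (mulLog g N) (1 + α + y * I)‖ ^ 2 / ‖(1 : ℂ) + α + y * I‖ ^ 2
      ≤ ∫ y in Set.Ico (-(a + 1)) (-a), ‖LSeries (mulLog g N) (1 + α + y * I)‖ ^ 2 / (1 + a ^ 2) := by
        refine setIntegral_mono_on hint.integrableOn ?_ measurableSet_Ico fun y hy => ?_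
        · exact (hcont.div_const _).integrableOn_Icc.mono_set Set.Ico_subset_Icc_self
        · refine normSq_div_le_of_le_abs hα.le ha ?_
          have : y < -a := hy.2
          rw [abs_of_neg (by linarith)]
          linarith
    _ = (∫ y in (-(a + 1))..(-a), ‖LSeries (mulLog g N) (1 + α + y * I)‖ ^ 2) / (1 + a ^ 2) := by
        rw [intervalIntegral.integral_of_le (by linarith), integral_Ico_eq_integral_Ioc, integral_div]
    _ ≤ 350 * Real.exp 10 / α ^ 3 / (1 + a ^ 2) := by
        gcongr
        have h := integral_unit_block_le (N := N) hgb hα hα1 (-(a + 1))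
        rwa [show -(a + 1) + 1 = -a by ring] at h

/-- The block weights telescope: `∑_{k < n} 1/(1 + (T₀+k)²) ≤ 1/(T₀ - 1)` for `T₀ ≥ 2`. [folklore] -/
theorem sum_range_inv_one_add_sq_le {T₀ : ℝ} (hT₀ : 2 ≤ T₀) (n : ℕ) :
    ∑ k ∈ Finset.range n, 1 / (1 + (T₀ + k) ^ 2) ≤ 1 / (T₀ - 1) := by
  have hstep : ∀ k : ℕ, 1 / (1 + (T₀ + k) ^ 2) ≤ 1 / (T₀ + k - 1) - 1 / (T₀ + k) := by
    intro k
    have hk : (0 : ℝ) ≤ k := Nat.cast_nonneg k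
    have h1 : 0 < T₀ + k - 1 := by linarith
    have h2 : 0 < T₀ + k := by linarith
    rw [div_sub_div _ _ h1.ne' h2.ne', div_le_div_iff₀ (by positivity) (by positivity)]
    nlinarith
  have htel : ∀ n : ℕ, ∑ k ∈ Finset.range n, (1 / (T₀ + k - 1) - 1 / (T₀ + k)) =
      1 / (T₀ - 1) - 1 / (T₀ + n - 1) := by
    intro n
    induction n with
    | zero => simp
    | succ m ih =>
        rw [Finset.sum_range_succ, ih]
        push_cast
        ring
  calc ∑ k ∈ Finset.range n, 1 / (1 + (T₀ + k) ^ 2)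
      ≤ ∑ k ∈ Finset.range n, (1 / (T₀ + k - 1) - 1 / (T₀ + k)) := Finset.sum_le_sum fun k _ => hstep k
    _ = 1 / (T₀ - 1) - 1 / (T₀ + n - 1) := htel n
    _ ≤ 1 / (T₀ - 1) := by
        have : 0 ≤ 1 / (T₀ + n - 1) := by
          have hn : (0 : ℝ) ≤ n := Nat.cast_nonneg n
          have : 0 < T₀ + n - 1 := by linarith
          positivity
        linarith

/-- **The right tail**: `∫_{y > T₀} |D|²/|s|² ≤ (1/(T₀-1)) · 350 e^{10}/α³` (`T₀ ≥ 2`).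
[cite: GranvilleSoundararajan2003, (3.11)] -/
theorem setIntegral_Ioi_tail_le (hgb : ∀ n, ‖g n‖ ≤ 1) {α : ℝ} (hα : 0 < α) (hα1 : α ≤ 1)
    {T₀ : ℝ} (hT₀ : 2 ≤ T₀) :
    ∫ y in Set.Ioi T₀, ‖LSeries (mulLog g N) (1 + α + y * I)‖ ^ 2
            / ‖(1 : ℂ) + α + y * I‖ ^ 2 ≤ 1 / (T₀ - 1) * (350 * Real.exp 10 / α ^ 3) := by
  set Q : ℝ := 350 * Real.exp 10 / α ^ 3 with hQ
  have hQ0 : 0 ≤ Q := by positivity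
  set S : ℕ → Set ℝ := fun k => Set.Ioc (T₀ + k) (T₀ + k + 1) with hS
  have hSm : ∀ k, MeasurableSet (S k) := fun k => measurableSet_Ioc
  have hSd : Pairwise (Function.onFun Disjoint S) := by
    intro k l hkl
    rcases lt_or_gt_of_ne hkl with h | h
    · refine Set.disjoint_left.2 fun y hy hy' => ?_
      have : (k : ℝ) + 1 ≤ l := by exact_mod_cast h
      simp only [hS, Set.mem_Ioc] at hy hy'
      linarith
    · refine Set.disjoint_left.2 fun y hy hy' => ?_
      have : (l : ℝ) + 1 ≤ k := by exact_mod_cast h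
      simp only [hS, Set.mem_Ioc] at hy hy'
      linarith
  have hSU : (⋃ k, S k) = Set.Ioi T₀ := by
    ext y
    simp only [Set.mem_iUnion, hS, Set.mem_Ioc, Set.mem_Ioi]
    constructor
    · rintro ⟨k, hk, -⟩
      have : (0 : ℝ) ≤ k := Nat.cast_nonneg k
      linarith
    · intro hy
      refine ⟨⌈y - T₀⌉₊ - 1, ?_, ?_⟩
      · have h1 : (1 : ℕ) ≤ ⌈y - T₀⌉₊ := Nat.one_le_iff_ne_zero.2 (by
          rw [Ne, Nat.ceil_eq_zero]; linarith)
        rw [Nat.cast_sub h1, Nat.cast_one]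
        have := Nat.ceil_lt_add_one (show 0 ≤ y - T₀ by linarith)
        linarith
      · have h1 : (1 : ℕ) ≤ ⌈y - T₀⌉₊ := Nat.one_le_iff_ne_zero.2 (by
          rw [Ne, Nat.ceil_eq_zero]; linarith)
        rw [Nat.cast_sub h1, Nat.cast_one]
        have := Nat.le_ceil (y - T₀)
        linarith
  have hint := integrable_normSq_mulLog_div (N := N) hgb hα
  have hsum := hasSum_integral_iUnion (μ := volume) (f := (fun y : ℝ => ‖LSeries (mulLog g N) (1 + α + y * I)‖ ^ 2
          / ‖(1 : ℂ) + α + y * I‖ ^ 2)) hSm hSd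
    hint.integrableOn
  rw [hSU] at hsum
  have hb : ∀ k : ℕ, ∫ y in S k, ‖LSeries (mulLog g N) (1 + α + y * I)‖ ^ 2
          / ‖(1 : ℂ) + α + y * I‖ ^ 2 ≤ Q * (1 / (1 + (T₀ + k) ^ 2)) := by
    intro k
    have hk : (0 : ℝ) ≤ T₀ + k := by have : (0:ℝ) ≤ k := Nat.cast_nonneg k; linarith
    have := setIntegral_Ioc_block_le (N := N) hgb hα hα1 hk
    simp only [hS]
    rw [mul_one_div]
    exact this
  have hbsum : Summable fun k : ℕ => Q * (1 / (1 + (T₀ + k) ^ 2)) := by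
    refine summable_of_sum_range_le (c := Q * (1 / (T₀ - 1))) (fun k => by positivity) fun n => ?_
    rw [← Finset.mul_sum]
    exact mul_le_mul_of_nonneg_left (sum_range_inv_one_add_sq_le hT₀ n) hQ0
  have htsum : ∑' k : ℕ, Q * (1 / (1 + (T₀ + k) ^ 2)) ≤ Q * (1 / (T₀ - 1)) := by
    refine Real.tsum_le_of_sum_range_le (fun k => by positivity) fun n => ?_
    rw [← Finset.mul_sum]
    exact mul_le_mul_of_nonneg_left (sum_range_inv_one_add_sq_le hT₀ n) hQ0
  calc ∫ y in Set.Ioi T₀, ‖LSeries (mulLog g N) (1 + α + y * I)‖ ^ 2 / ‖(1 : ℂ) + α + y * I‖ ^ 2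
      = ∑' k : ℕ, ∫ y in S k, ‖LSeries (mulLog g N) (1 + α + y * I)‖ ^ 2
              / ‖(1 : ℂ) + α + y * I‖ ^ 2 := hsum.tsum_eq.symm
    _ ≤ ∑' k : ℕ, Q * (1 / (1 + (T₀ + k) ^ 2)) := hsum.summable.tsum_le_tsum hb hbsum
    _ ≤ Q * (1 / (T₀ - 1)) := htsum
    _ = 1 / (T₀ - 1) * Q := by ring

/-- **The left tail**: `∫_{y < -T₀} |D|²/|s|² ≤ (1/(T₀-1)) · 350 e^{10}/α³` (`T₀ ≥ 2`).
[cite: GranvilleSoundararajan2003, (3.11)] -/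
theorem setIntegral_Iio_tail_le (hgb : ∀ n, ‖g n‖ ≤ 1) {α : ℝ} (hα : 0 < α) (hα1 : α ≤ 1)
    {T₀ : ℝ} (hT₀ : 2 ≤ T₀) :
    ∫ y in Set.Iio (-T₀), ‖LSeries (mulLog g N) (1 + α + y * I)‖ ^ 2
            / ‖(1 : ℂ) + α + y * I‖ ^ 2 ≤ 1 / (T₀ - 1) * (350 * Real.exp 10 / α ^ 3) := by
  set Q : ℝ := 350 * Real.exp 10 / α ^ 3 with hQ
  have hQ0 : 0 ≤ Q := by positivity
  set S : ℕ → Set ℝ := fun k => Set.Ico (-(T₀ + k + 1)) (-(T₀ + k)) with hS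
  have hSm : ∀ k, MeasurableSet (S k) := fun k => measurableSet_Ico
  have hSd : Pairwise (Function.onFun Disjoint S) := by
    intro k l hkl
    rcases lt_or_gt_of_ne hkl with h | h
    · refine Set.disjoint_left.2 fun y hy hy' => ?_
      have : (k : ℝ) + 1 ≤ l := by exact_mod_cast h
      simp only [hS, Set.mem_Ico] at hy hy'
      linarith
    · refine Set.disjoint_left.2 fun y hy hy' => ?_
      have : (l : ℝ) + 1 ≤ k := by exact_mod_cast h
      simp only [hS, Set.mem_Ico] at hy hy'
      linarith
  have hSU : (⋃ k, S k) = Set.Iio (-T₀) := by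
    ext y
    simp only [Set.mem_iUnion, hS, Set.mem_Ico, Set.mem_Iio]
    constructor
    · rintro ⟨k, -, hk⟩
      have : (0 : ℝ) ≤ k := Nat.cast_nonneg k
      linarith
    · intro hy
      refine ⟨⌈-y - T₀⌉₊ - 1, ?_, ?_⟩
      · have h1 : (1 : ℕ) ≤ ⌈-y - T₀⌉₊ := Nat.one_le_iff_ne_zero.2 (by
          rw [Ne, Nat.ceil_eq_zero]; linarith)
        rw [Nat.cast_sub h1, Nat.cast_one]
        have := Nat.le_ceil (-y - T₀)
        linarith
      · have h1 : (1 : ℕ) ≤ ⌈-y - T₀⌉₊ := Nat.one_le_iff_ne_zero.2 (by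
          rw [Ne, Nat.ceil_eq_zero]; linarith)
        rw [Nat.cast_sub h1, Nat.cast_one]
        have := Nat.ceil_lt_add_one (show 0 ≤ -y - T₀ by linarith)
        linarith
  have hint := integrable_normSq_mulLog_div (N := N) hgb hα
  have hsum := hasSum_integral_iUnion (μ := volume) (f := (fun y : ℝ => ‖LSeries (mulLog g N) (1 + α + y * I)‖ ^ 2
          / ‖(1 : ℂ) + α + y * I‖ ^ 2)) hSm hSd
    hint.integrableOn
  rw [hSU] at hsum
  have hb : ∀ k : ℕ, ∫ y in S k, ‖LSeries (mulLog g N) (1 + α + y * I)‖ ^ 2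
          / ‖(1 : ℂ) + α + y * I‖ ^ 2 ≤ Q * (1 / (1 + (T₀ + k) ^ 2)) := by
    intro k
    have hk : (0 : ℝ) ≤ T₀ + k := by have : (0:ℝ) ≤ k := Nat.cast_nonneg k; linarith
    have := setIntegral_Ico_block_le (N := N) hgb hα hα1 hk
    simp only [hS]
    rw [mul_one_div]
    exact this
  have hbsum : Summable fun k : ℕ => Q * (1 / (1 + (T₀ + k) ^ 2)) := by
    refine summable_of_sum_range_le (c := Q * (1 / (T₀ - 1))) (fun k => by positivity) fun n => ?_
    rw [← Finset.mul_sum]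
    exact mul_le_mul_of_nonneg_left (sum_range_inv_one_add_sq_le hT₀ n) hQ0
  have htsum : ∑' k : ℕ, Q * (1 / (1 + (T₀ + k) ^ 2)) ≤ Q * (1 / (T₀ - 1)) := by
    refine Real.tsum_le_of_sum_range_le (fun k => by positivity) fun n => ?_
    rw [← Finset.mul_sum]
    exact mul_le_mul_of_nonneg_left (sum_range_inv_one_add_sq_le hT₀ n) hQ0
  calc ∫ y in Set.Iio (-T₀), ‖LSeries (mulLog g N) (1 + α + y * I)‖ ^ 2 / ‖(1 : ℂ) + α + y * I‖ ^ 2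
      = ∑' k : ℕ, ∫ y in S k, ‖LSeries (mulLog g N) (1 + α + y * I)‖ ^ 2
              / ‖(1 : ℂ) + α + y * I‖ ^ 2 := hsum.tsum_eq.symm
    _ ≤ ∑' k : ℕ, Q * (1 / (1 + (T₀ + k) ^ 2)) := hsum.summable.tsum_le_tsum hb hbsum
    _ ≤ Q * (1 / (T₀ - 1)) := htsum
    _ = 1 / (T₀ - 1) * Q := by ring


/-! ### The mean square bound (GS03 Lemma 3.2, completely multiplicative case) -/

/-- Splitting `∫_ℝ = ∫_{[-T₀,T₀]} + ∫_{(-∞,-T₀)} + ∫_{(T₀,∞)}` for the nonnegative integrable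
function `|D(1+α+iy)|²/|1+α+iy|²`. [folklore] -/
theorem integral_le_window_add_tails (hgb : ∀ n, ‖g n‖ ≤ 1) {α : ℝ} (hα : 0 < α) {T₀ : ℝ}
    (hT₀ : 0 ≤ T₀) :
    ∫ y : ℝ, ‖LSeries (mulLog g N) (1 + α + y * I)‖ ^ 2 / ‖(1 : ℂ) + α + y * I‖ ^ 2 ≤
      (∫ y in Set.Icc (-T₀) T₀, ‖LSeries (mulLog g N) (1 + α + y * I)‖ ^ 2 / ‖(1 : ℂ) + α + y * I‖ ^ 2) +
        ((∫ y in Set.Iio (-T₀), ‖LSeries (mulLog g N) (1 + α + y * I)‖ ^ 2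
                / ‖(1 : ℂ) + α + y * I‖ ^ 2) + ∫ y in Set.Ioi T₀, ‖LSeries (mulLog g N) (1 + α + y * I)‖ ^ 2
                / ‖(1 : ℂ) + α + y * I‖ ^ 2) := by
  have hint := integrable_normSq_mulLog_div (N := N) hgb hα
  rw [← integral_add_compl (measurableSet_Icc (a := -T₀) (b := T₀)) hint]
  gcongr
  have hsub : (Set.Icc (-T₀) T₀)ᶜ ⊆ Set.Iio (-T₀) ∪ Set.Ioi T₀ := by
    intro y hy
    simp only [Set.mem_compl_iff, Set.mem_Icc, not_and_or, not_le] at hy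
    rcases hy with h | h
    · exact Or.inl h
    · exact Or.inr h
  calc ∫ y in (Set.Icc (-T₀) T₀)ᶜ, ‖LSeries (mulLog g N) (1 + α + y * I)‖ ^ 2 / ‖(1 : ℂ) + α + y * I‖ ^ 2
      ≤ ∫ y in Set.Iio (-T₀) ∪ Set.Ioi T₀, ‖LSeries (mulLog g N) (1 + α + y * I)‖ ^ 2 / ‖(1 : ℂ) + α + y * I‖ ^ 2 :=
        setIntegral_mono_set hint.integrableOn
          (Filter.Eventually.of_forall fun y => by positivity) hsub.eventuallyLE
    _ = (∫ y in Set.Iio (-T₀), ‖LSeries (mulLog g N) (1 + α + y * I)‖ ^ 2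
            / ‖(1 : ℂ) + α + y * I‖ ^ 2) + ∫ y in Set.Ioi T₀, ‖LSeries (mulLog g N) (1 + α + y * I)‖ ^ 2
            / ‖(1 : ℂ) + α + y * I‖ ^ 2 := by
        refine setIntegral_union ?_ measurableSet_Ioi hint.integrableOn hint.integrableOn
        exact Set.disjoint_left.2 fun y hy hy' => by
          simp only [Set.mem_Iio] at hy; simp only [Set.mem_Ioi] at hy'
          linarith

/-- **Granville–Soundararajan 2003, Lemma 3.2 with (3.9)–(3.10), completely multiplicative case**
(crude explicit constants).  Let `g` be completely multiplicative with `|g| ≤ 1`, `g̃` its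
`(N+1)`-smooth truncation, `0 < α ≤ 1`, `T₀ ≥ 2`, and suppose `|G(1+α+iy)| ≤ B` for `|y| ≤ T₀`, where
`G(s) = ∑ g̃(n) n^{-s}`.  Then the weighted mean square of `A(y) = ∑_{n ≤ y} g̃(n) log n` satisfies
`∫_ℝ |A(e^u)|² e^{-2(1+α)u} du ≤ 18 B²/α + 223 e^{10}/(T₀ α³)`.
(GS03 prove, for general multiplicative `f` and with `T`-blocks,
`(1/2π)∫|F'/s|² ≤ max_{|y|≤T}|F|² (1-x^{-2α})/(2α) + O(1/T + m³/T² + m²)`.)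
[cite: GranvilleSoundararajan2003, Lemma 3.2 and (3.9)–(3.10)] -/
theorem meanSquare_mulLog_le (hg : ∀ m n, g (m * n) = g m * g n) (hg1 : g 1 = 1)
    (hgb : ∀ n, ‖g n‖ ≤ 1) (N : ℕ) {α : ℝ} (hα : 0 < α) (hα1 : α ≤ 1) {T₀ : ℝ} (hT₀ : 2 ≤ T₀)
    {B : ℝ} (hB : ∀ y : ℝ, |y| ≤ T₀ → ‖LSeries (smoothCut g N) (1 + α + y * I)‖ ≤ B) :
    ∫ u : ℝ, ‖psum (mulLog g N) (Real.exp u)‖ ^ 2 * Real.exp (-(2 * (1 + α) * u)) ≤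
      18 * B ^ 2 / α + 223 * Real.exp 10 / (T₀ * α ^ 3) := by
  set Q : ℝ := 350 * Real.exp 10 / α ^ 3 with hQ
  have hQ0 : 0 ≤ Q := by positivity
  -- the `P`-integral
  set IP : ℝ := ∫ y : ℝ, ‖LSeries (mulVM g N) (1 + α + y * I)‖ ^ 2 / ‖(1 : ℂ) + α + y * I‖ ^ 2
    with hIP
  have hIP_le : IP ≤ 2 * π * (18 / α) := by
    have h1 := meanSquare_mulVM_eq (N := N) hgb hα
    have h2 := meanSquare_mulVM_le (N := N) hgb hα
    rw [h1] at h2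
    have hπ : 0 < 2 * π := by positivity
    calc IP = 2 * π * (1 / (2 * π) * IP) := by field_simp
      _ ≤ 2 * π * (18 / α) := by gcongr
  -- the `D`-integral, split
  have hD : ∫ y : ℝ, ‖LSeries (mulLog g N) (1 + α + y * I)‖ ^ 2
          / ‖(1 : ℂ) + α + y * I‖ ^ 2 ≤ B ^ 2 * IP + 2 * (1 / (T₀ - 1) * Q) := by
    refine (integral_le_window_add_tails (N := N) hgb hα (by linarith : (0:ℝ) ≤ T₀)).trans ?_
    have hw : ∫ y in Set.Icc (-T₀) T₀, ‖LSeries (mulLog g N) (1 + α + y * I)‖ ^ 2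
            / ‖(1 : ℂ) + α + y * I‖ ^ 2 ≤ B ^ 2 * IP :=
      setIntegral_window_le (N := N) hg hg1 hgb hα (T₀ := T₀) hB
    have ht1 : ∫ y in Set.Iio (-T₀), ‖LSeries (mulLog g N) (1 + α + y * I)‖ ^ 2
            / ‖(1 : ℂ) + α + y * I‖ ^ 2 ≤ 1 / (T₀ - 1) * Q :=
      setIntegral_Iio_tail_le (N := N) hgb hα hα1 hT₀
    have ht2 : ∫ y in Set.Ioi T₀, ‖LSeries (mulLog g N) (1 + α + y * I)‖ ^ 2
            / ‖(1 : ℂ) + α + y * I‖ ^ 2 ≤ 1 / (T₀ - 1) * Q :=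
      setIntegral_Ioi_tail_le (N := N) hgb hα hα1 hT₀
    linarith
  have hJ := meanSquare_mulLog_eq (N := N) hgb hα
  rw [hJ]
  have hπ0 : 0 < 1 / (2 * π) := by positivity
  have hT1 : 1 / (T₀ - 1) ≤ 2 / T₀ := by
    rw [div_le_div_iff₀ (by linarith) (by linarith)]; linarith
  have hT0' : 0 < T₀ := by linarith
  calc 1 / (2 * π) * ∫ y : ℝ, ‖LSeries (mulLog g N) (1 + α + y * I)‖ ^ 2 / ‖(1 : ℂ) + α + y * I‖ ^ 2
      ≤ 1 / (2 * π) * (B ^ 2 * IP + 2 * (1 / (T₀ - 1) * Q)) := by gcongr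
    _ ≤ 1 / (2 * π) * (B ^ 2 * (2 * π * (18 / α)) + 2 * (2 / T₀ * Q)) := by gcongr
    _ = 18 * B ^ 2 / α + (2 / π) * Q / T₀ := by field_simp
    _ ≤ 18 * B ^ 2 / α + (223 / 350) * Q / T₀ := by
        have hπ3 : (3.14 : ℝ) < π := Real.pi_gt_d2
        have h2π : 2 / π ≤ 223 / 350 := by
          rw [div_le_div_iff₀ Real.pi_pos (by norm_num)]; nlinarith
        gcongr
    _ = 18 * B ^ 2 / α + 223 * Real.exp 10 / (T₀ * α ^ 3) := by
        simp only [hQ]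
        field_simp

end Halasz

end Literature.NumberTheory.LFunctions
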